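import Literature.NumberTheory.EllipticCurves.MultiplicativeReductionPeuRamifieProofs
import HarnessLib

/-!
# BSD rank-≤1 residual cell: the inertia-equivariant transport `Ψ : E(K̄) → T(K̄_v)` to the Tate
# form of invariant `j(E)` at a multiplicative `v ∣ p` (tool lemma, packaged once)

HONEST FRAMING (cell `b2b-bsdres-*`, verbatim): the goal of the cell is to DELETE the
COMBINATION-SHAPED residual classes for ALL analytic-rank `≤ 1` elliptic curves over `ℚ` — "full BSD
formula for every rank `≤ 1` curve in class C" assembled STRICTLY from published theorems — so that
the rank-`≤ 1` remainder becomes exactly the CONSTRUCTION-SHAPED classes, which are TYPED, NOT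
attempted; this is not "finishing BSD".  Unit `b2b-bsdres-x11c` (gen 8).  Theorems only (no
definition, no named fact); a TOOL file, no class theorem, no label moves.

`Step 0–2` of the tree's `isPeuRamifie_restrictField_of_hasMultiplicativeReductionAt_of_dvd`
(`MultiplicativeReductionPeuRamifieProofs`) and of `exists_line_le_geomTorsion_of_…`
(`MultiplicativeReductionInertiaShapeProofs`) construct, inline, the same object: for an elliptic
curve `E` over a number field `K`, an odd prime `p` and a place `v ∣ p` of MULTIPLICATIVE reduction,
an injective homomorphism `Ψ : E(K̄) → T(K̄_v)` onto the Tate form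
`T : y² + xy = x³ - 36x/(j-1728) - 1/(j-1728)` of invariant `j = j(E)` (Silverman *AEC* III.1.4(c);
`|a₆(T)| = |j|⁻¹ = |Δ_min|_v`), which is EQUIVARIANT for the inertia group `I_𝔐 ≤ Γ_{K_v}` acting on
`E(K̄)` through `Γ_{K_v} → Γ_K` — because the quadratic twist `E ≃ T` is by the square class of
`c₆(E)c₄(T)/(c₄(E)c₆(T))`, a `v`-UNIT when the reduction is multiplicative, and `p ≠ 2`
(Serre 1972 §1.12: over `K_v^nr` a curve with multiplicative reduction is a Tate curve).  This file
states that construction ONCE as an existence theorem, so that further local arguments at `ℓ = p`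
(this gen's `MultiplicativeInertiaFixedPoints.lean`; later the unit half of the Kummer criterion)
do not copy 150 lines each time:

* `exists_tateForm_transport_of_hasMultiplicativeReductionAt` — **there is an injective additive
  `Ψ : E(K̄) → T(K̄_v)` with `Ψ(res(τ) • P) = (Ψ P)^τ` for all `τ ∈ I_𝔐`, such that every point of
  `p`-power order of `E(K̄)` whose image is affine and not small (`|x| ≥ 1`) has its image in the
  kernel of reduction (`|x| > 1`)** (a `p`-power torsion point of `T₀ ∖ T₁` would reduce to a
  non-trivial `p`-power torsion point of `κˣ`, `char κ = p`: `TateForm.reducesToZero_congrEquiv_of_not_isSmall`).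

## References

* [SerreInventiones1972] J.-P. Serre, Invent. Math. 15 (1972), §1.12.
* [SilvermanAEC2009] J. H. Silverman, *AEC* 2nd ed., III.1.4(b),(c), X.5.4, VII.2.1, VII.5.1(b).
* [SilvermanATAEC1994] J. H. Silverman, *Advanced Topics*, V.3 Thm. 3.1, V.5 Lemma 5.1.
-/

noncomputable section

open scoped Classical NNReal NumberField Pointwise
open NumberField IsDedekindDomain Field

namespace Summit.BirchSwinnertonDyer.Rank1Residual.GaloisImage

open WeierstrassCurve Literature.NumberTheory.EllipticCurves Literature.NumberTheory.GaloisRepresentations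
  IsDedekindDomain.HeightOneSpectrum

set_option maxHeartbeats 800000 in
/-- **The inertia-equivariant transport to the Tate form at a multiplicative `v ∣ p`, `p` odd.**
For `E` elliptic over a number field `K`, `p ≠ 2` prime, `v ∣ p` of multiplicative reduction, `|·|`
the spectral valuation of `K̄_v` and `𝔐` the prime of `\bar 𝓞_v`: there is an injective additive map
`Ψ : E(K̄) → T(K̄_v)`, `T` the Tate form of invariant `j(E)` over `K_v`, with
`Ψ(res τ • P) = (Ψ P)^τ` for every `τ ∈ I_𝔐` (`res : Γ_{K_v} → Γ_K` the tree's `absGaloisRestrict`),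
and such that for every `P ∈ E(K̄)` killed by a power of `p` with `Ψ P = (x, y)` not small
(`|x| ≥ 1`) one has `|x| > 1` (kernel of reduction).  Construction = Steps 0–2 of the tree's
`isPeuRamifie_restrictField_of_hasMultiplicativeReductionAt_of_dvd`, verbatim.
[cite: SerreInventiones1972, §1.12 (Cor. of Prop. 13)] [cite: SilvermanAEC2009, Prop. III.1.4(b),(c), X.5.4 and VII.5.1(b)] -/
theorem exists_tateForm_transport_of_hasMultiplicativeReductionAt
    {K : Type} [Field K] [NumberField K] (W : WeierstrassCurve K) [W.IsElliptic]
    (p : ℕ) [hp : Fact p.Prime] (hp2 : p ≠ 2)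
    (v : HeightOneSpectrum (𝓞 K)) (hpv : (p : 𝓞 K) ∈ v.asIdeal)
    (hmult : W.HasMultiplicativeReductionAt v)
    {w : Valuation (AlgebraicClosure (v.adicCompletion K)) ℝ≥0}
    (hw : ∀ x, (w x : ℝ) =
      spectralNorm (v.adicCompletion K) (AlgebraicClosure (v.adicCompletion K)) x)
    {𝔐 : Ideal v.localAbsIntegers} (h𝔐 : 𝔐 ∈ v.localPrimesAbove) :
    ∃ Ψ : geomPoints W →+ ((tateFormOfJ (algebraMap K (v.adicCompletion K) W.j)).baseChange
        (AlgebraicClosure (v.adicCompletion K))).toAffine.Point,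
      Function.Injective Ψ ∧
      (∀ τ ∈ 𝔐.inertia (absoluteGaloisGroup (v.adicCompletion K)), ∀ P : geomPoints W,
        Ψ (absGaloisRestrict K (v.adicCompletion K) τ • P) =
          Affine.Point.map ((absoluteGaloisGroup.toAlgEquiv (v.adicCompletion K) τ :
            (AlgebraicClosure (v.adicCompletion K)) ≃ₐ[(v.adicCompletion K)]
              (AlgebraicClosure (v.adicCompletion K))) :
            (AlgebraicClosure (v.adicCompletion K)) →ₐ[(v.adicCompletion K)]
              (AlgebraicClosure (v.adicCompletion K))) (Ψ P)) ∧
      (∀ (P : geomPoints W) (n : ℕ), ((p ^ n : ℕ) : ℤ) • P = 0 → ∀ {x y}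
        {hxy : ((tateFormOfJ (algebraMap K (v.adicCompletion K) W.j)).baseChange
          (AlgebraicClosure (v.adicCompletion K))).toAffine.Nonsingular x y},
        Ψ P = .some x y hxy → ¬ w x < 1 → 1 < w x) := by
  haveI : CharZero (v.adicCompletion K) :=
    charZero_of_injective_algebraMap (algebraMap K (v.adicCompletion K)).injective
  haveI : CharZero (AlgebraicClosure (v.adicCompletion K)) :=
    charZero_of_injective_algebraMap
      (algebraMap (v.adicCompletion K) (AlgebraicClosure (v.adicCompletion K))).injective
  have hvw : w.Integers w.integer := Valuation.integer.integers w
  have hjw : 1 < w (algebraMap K (AlgebraicClosure (v.adicCompletion K)) W.j) :=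
    W.one_lt_spectralValuation_j_of_hasMultiplicativeReductionAt hw hmult
  obtain ⟨hj0, hj1728, hT, -, -, -⟩ := W.isTateForm_tateFormOfJ_of_one_lt hjw
  set jv : (v.adicCompletion K) := algebraMap K (v.adicCompletion K) W.j with hjv
  haveI hTell : (tateFormOfJ jv).IsElliptic := isElliptic_tateFormOfJ hj0 hj1728
  have hjW : (W.baseChange (v.adicCompletion K)).j = jv := W.map_j _
  have hjE : (W.baseChange (v.adicCompletion K)).j = (tateFormOfJ jv).j := by
    rw [hjW, tateFormOfJ_j hj0 hj1728]
  have hjE0 : (W.baseChange (v.adicCompletion K)).j ≠ 0 := by rw [hjW]; exact hj0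
  have hjE1728 : (W.baseChange (v.adicCompletion K)).j ≠ 1728 := by rw [hjW]; exact hj1728
  obtain ⟨eT, u, hu0, ⟨r, hr0, hur⟩, heT⟩ := exists_addEquiv_baseChange_of_j_eq_map_algEquiv_c₄c₆
    (W.baseChange (v.adicCompletion K)) (tateFormOfJ jv) (AlgebraicClosure (v.adicCompletion K))
    hjE hjE0 hjE1728
  set f := algebraMap (v.adicCompletion K) (AlgebraicClosure (v.adicCompletion K)) with hf
  -- (1) the minimal model has unit `c₄`, `c₆`; so has the Tate form
  obtain ⟨C, hC⟩ : ∃ C : VariableChange (v.adicCompletion K),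
      W.localMinimalModel v = C • W.baseChange (v.adicCompletion K) := ⟨_, rfl⟩
  set I := W.localMinimalIntegralModel v with hIdef
  obtain ⟨hΔm, hc₄m⟩ := (hasMultiplicativeReductionAt_iff_mem v W).mp hmult
  have hc₄u : IsUnit I.c₄ := by
    by_contra h
    exact hc₄m ((IsLocalRing.mem_maximalIdeal _).mpr (mem_nonunits_iff.mpr h))
  have hc₆u : IsUnit I.c₆ := by
    by_contra h
    have hc₆m : I.c₆ ∈ IsLocalRing.maximalIdeal _ :=
      (IsLocalRing.mem_maximalIdeal _).mpr (mem_nonunits_iff.mpr h)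
    apply hc₄m
    refine Ideal.IsPrime.mem_of_pow_mem inferInstance 3 ?_
    rw [show I.c₄ ^ 3 = I.c₆ ^ 2 + 1728 * I.Δ by linear_combination -I.c_relation]
    exact Ideal.add_mem _ (Ideal.pow_mem_of_mem _ hc₆m 2 two_pos) (Ideal.mul_mem_left _ _ hΔm)
  have hXI : I.baseChange (v.adicCompletion K) = W.localMinimalModel v :=
    baseChange_integralModel_eq (v.adicCompletionIntegers K) (W.localMinimalModel v)
  have hXc₄ : (W.localMinimalModel v).c₄ = algebraMap _ (v.adicCompletion K) I.c₄ := by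
    rw [← hXI]; exact (I.map_c₄ _)
  have hXc₆ : (W.localMinimalModel v).c₆ = algebraMap _ (v.adicCompletion K) I.c₆ := by
    rw [← hXI]; exact (I.map_c₆ _)
  have hwc₄ : w (f (W.localMinimalModel v).c₄) = 1 := by
    rw [hXc₄]; exact spectralValuation_eq_one_of_isUnit hw hc₄u
  have hwc₆ : w (f (W.localMinimalModel v).c₆) = 1 := by
    rw [hXc₆]; exact spectralValuation_eq_one_of_isUnit hw hc₆u
  have hEc₄ : (W.baseChange (v.adicCompletion K)).c₄ =
      (C.u : (v.adicCompletion K)) ^ 4 * (W.localMinimalModel v).c₄ := by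
    rw [hC, variableChange_c₄, Units.val_inv_eq_inv_val, ← mul_assoc, ← mul_pow,
      mul_inv_cancel₀ C.u.ne_zero, one_pow, one_mul]
  have hEc₆ : (W.baseChange (v.adicCompletion K)).c₆ =
      (C.u : (v.adicCompletion K)) ^ 6 * (W.localMinimalModel v).c₆ := by
    rw [hC, variableChange_c₆, Units.val_inv_eq_inv_val, ← mul_assoc, ← mul_pow,
      mul_inv_cancel₀ C.u.ne_zero, one_pow, one_mul]
  have hTc₄ : w (f (tateFormOfJ jv).c₄) = 1 := by
    rw [hf, ← map_c₄]; exact hT.valuation_c₄ w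
  have hTc₆ : w (f (tateFormOfJ jv).c₆) = 1 := by
    rw [hf, ← map_c₆]; exact hT.valuation_c₆ w
  -- (2) the unit `u' = u · r⁻¹ · u_C⁻¹`: every inertia element fixes `u`
  set u' : (AlgebraicClosure (v.adicCompletion K)) :=
    u * f (r⁻¹ * (C.u : (v.adicCompletion K))⁻¹) with hu'
  have hu'2 : u' ^ 2 = f ((W.localMinimalModel v).c₆ * (tateFormOfJ jv).c₄ /
      ((W.localMinimalModel v).c₄ * (tateFormOfJ jv).c₆)) := by
    rw [hu', mul_pow, hur, ← map_pow, ← map_mul, hEc₄, hEc₆]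
    congr 1
    have hCu : (C.u : (v.adicCompletion K)) ≠ 0 := C.u.ne_zero
    field_simp
  have hwu' : w u' = 1 := by
    have h2 : w u' ^ 2 = 1 := by
      rw [← Valuation.map_pow, hu'2, map_div₀, map_mul, map_mul, Valuation.map_div,
        Valuation.map_mul, Valuation.map_mul, hwc₆, hTc₄, hwc₄, hTc₆]
      simp
    exact (pow_eq_one_iff.mp h2).resolve_right two_ne_zero
  have h2w : w (2 : (AlgebraicClosure (v.adicCompletion K))) = 1 := by
    have := spectralValuation_intCast_eq_one hw (two_not_mem_asIdeal_of_prime_mem hp.out hp2 hpv)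
    simpa using this
  have hfixu : ∀ σ ∈ 𝔐.inertia (absoluteGaloisGroup (v.adicCompletion K)),
      absoluteGaloisGroup.toAlgEquiv (v.adicCompletion K) σ u = u := by
    intro σ hσ
    set σE : (AlgebraicClosure (v.adicCompletion K)) ≃ₐ[(v.adicCompletion K)]
      (AlgebraicClosure (v.adicCompletion K)) := absoluteGaloisGroup.toAlgEquiv _ σ with hσE
    rcases (heT σE).1 with hfix' | hneg
    · exact hfix'
    · exfalso
      have hσu' : σE u' = -u' := by
        rw [hu', map_mul, hneg, AlgEquiv.commutes, neg_mul]
      have hlt := (mem_inertia_iff_spectralValuation hw h𝔐).mp hσ u' hwu'.le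
      have heq : σ • u' - u' = -(2 * u') := by
        change σE u' - u' = -(2 * u')
        rw [hσu']; ring
      rw [heq, Valuation.map_neg, Valuation.map_mul, h2w, hwu', one_mul] at hlt
      exact lt_irrefl _ hlt
  -- (3) the transport `Ψ`
  haveI hint : ((tateFormOfJ jv).baseChange (AlgebraicClosure (v.adicCompletion K))).IsIntegral
      w.integer := hT.isIntegral
  let Φ : localPoints W (v.adicCompletion K) ≃+
      ((tateFormOfJ jv).baseChange (AlgebraicClosure (v.adicCompletion K))).toAffine.Point :=
    (Affine.Point.congrEquiv (baseChange_baseChange_adicCompletion W v).symm).trans eT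
  have hΦ : ∀ σ ∈ 𝔐.inertia (absoluteGaloisGroup (v.adicCompletion K)),
      ∀ Q : localPoints W (v.adicCompletion K),
      Φ (σ • Q) = Affine.Point.map ((absoluteGaloisGroup.toAlgEquiv (v.adicCompletion K) σ :
        (AlgebraicClosure (v.adicCompletion K)) ≃ₐ[(v.adicCompletion K)]
          (AlgebraicClosure (v.adicCompletion K))) :
        (AlgebraicClosure (v.adicCompletion K)) →ₐ[(v.adicCompletion K)]
          (AlgebraicClosure (v.adicCompletion K))) (Φ Q) := by
    intro σ hσ Q
    change eT (Affine.Point.congrEquiv (baseChange_baseChange_adicCompletion W v).symm (σ • Q)) =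
      Affine.Point.map ((absoluteGaloisGroup.toAlgEquiv (v.adicCompletion K) σ :
        (AlgebraicClosure (v.adicCompletion K)) ≃ₐ[(v.adicCompletion K)]
          (AlgebraicClosure (v.adicCompletion K))) :
        (AlgebraicClosure (v.adicCompletion K)) →ₐ[(v.adicCompletion K)]
          (AlgebraicClosure (v.adicCompletion K)))
        (eT (Affine.Point.congrEquiv (baseChange_baseChange_adicCompletion W v).symm Q))
    rw [congrEquiv_smul, (heT _).2, if_pos (hfixu σ hσ)]
  set Ψ : geomPoints W →+
      ((tateFormOfJ jv).baseChange (AlgebraicClosure (v.adicCompletion K))).toAffine.Point :=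
    Φ.toAddMonoidHom.comp (pointsMap W (v.adicCompletion K)) with hΨ
  have hΨinj : Function.Injective Ψ :=
    Φ.injective.comp (pointsMapOfEmb_injective W (closureEmb (K := K) (v.adicCompletion K)))
  obtain ⟨M, hM⟩ := hint.integral
  have hpw : w (p : (AlgebraicClosure (v.adicCompletion K))) < 1 :=
    spectralValuation_natCast_lt_one hw hpv
  have hT' : TateForm.IsTateForm w (M.baseChange (AlgebraicClosure (v.adicCompletion K))) := by
    rw [← hM]; exact hT
  refine ⟨Ψ, hΨinj, fun τ hτ P ↦ ?_, fun P n hPn x y hxy hPeq hns ↦ ?_⟩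
  · -- equivariance
    rw [hΨ, AddMonoidHom.coe_comp, Function.comp_apply, ← resGal_eq_absGaloisRestrict,
      pointsMap_smul]
    exact hΦ τ hτ _
  · -- a `p`-power torsion point which is not small lies in the kernel of reduction
    have hPn' : ((p ^ n : ℕ) : ℤ) • Ψ P = 0 := by rw [← map_zsmul, hPn, map_zero]
    have hns' : ¬ TateForm.IsSmall w (Ψ P) := by
      rw [hPeq, TateForm.isSmall_some]; exact hns
    have hred := TateForm.reducesToZero_congrEquiv_of_not_isSmall hM hT' hpw hns' hPn'
    rw [hPeq, Affine.Point.congrEquiv_some, reducesToZero_some_iff, not_mem_range_iff hvw] at hred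
    exact hred

end Summit.BirchSwinnertonDyer.Rank1Residual.GaloisImage

end
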